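import Summits.BirchSwinnertonDyer.Rank1Residual.GaloisImage.PadicRootCensus
import HarnessLib

/-!
# Root census with the TAYLOR EXCLUSION TEST: a residue class `r + p^j ℤ_p` is DEAD when the
# constant Taylor coefficient of `F` at `r` strictly dominates (team n1011, row T-LOC3T, FILE A1b —
# generic in the prime `p`; sequel of `PadicRootCensus`)

HONEST FRAMING (cell `b2b-bsdres`, run/shared/lean/b2b/bsd-rank1-residual/, verbatim in every
file): the goal of the cell is to DELETE the COMBINATION-SHAPED residual classes of the
Birch–Swinnerton-Dyer formula for ALL analytic-rank `≤ 1` elliptic curves over `ℚ` — "full BSD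
formula for every rank `≤ 1` curve in class `C`" assembled STRICTLY from published theorems — so
that the rank-`≤ 1` remainder becomes exactly the CONSTRUCTION-SHAPED classes, which are TYPED
(missing-input `Prop`s), NOT attempted. This is not "finishing BSD". Team n1011 (N10/N11): research
route; this file is a TOOL (pure `p`-adic algebra); nothing is booked by it; no mark / label moved.
No named fact, no `sorry`; the only definitions are COMPUTABLE bookkeeping (Taylor coefficient
lists, a fuelled valuation, and the Boolean checker `RootCensus.check₂`).

## Why a second checker

`PadicRootCensus.check`'s residue tree search keeps a class `r (mod p^j)` alive as long as
`F(r) ≡ 0 (mod p^j)`. When `F` has conjugate roots in a RAMIFIED extension lying close to `ℤ_p`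
(for the consumer `Ψ₃` of an elliptic curve with additive, potentially multiplicative reduction of
type `I*_ν` at `3`: the three non-rational `3`-torsion abscissae), the number of such classes
grows like `p^{2j/3}` up to level `≈ ν` — e.g. `3^{28}` for the route-1 pilot 22077e1 (`ν = 42`).
The classical remedy is the TAYLOR EXCLUSION TEST: writing `F(r + p^j t) = Σ cᵢ p^{ij} tⁱ` with the
integer Taylor coefficients `cᵢ` of `F` at `r`, the class `r + p^j ℤ_p` contains NO root as soon as
`v_p(c₀) < v_p(cᵢ) + i j` for all `i ≥ 1` (`RootCensus.aeval_ne_zero_of_dead`). With it the tree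
search expands only `O(#roots)` classes per level (27 nodes at most on p14's 341 `m = 3` cells; 51
on 22077e1).

## What

* `taylorList l r` (computable, by synthetic division) with
  `aeval y (ofList (taylorList l r)) = aeval (y + r) (ofList l)`;
* `valFuel p fuel n` with `p ^ valFuel p fuel n ∣ n`;
* `dead p l j r : Bool` and its soundness `aeval_ne_zero_of_dead`;
* `check₂ p l k cert` = `PadicRootCensus.check` with `alive` strengthened by `¬ dead`, and the
  soundness of its tree search `inBall_of_coverOK₂` (every root of `F` in `ℤ_p` lies in a certified
  Hensel ball). The census theorem for `check₂` is in FILE A2 `PadicRootCensusRoots`.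

References: standard (exclusion/inclusion tests for `p`-adic root isolation; Hensel's lemma).
-/

set_option autoImplicit false

open Polynomial

namespace Summit.BirchSwinnertonDyer.Rank1Residual.GaloisImage.RootCensus

/-! ### Taylor coefficients by synthetic division -/

/-- Add `g` to the head coefficient (`g + (c₀ + c₁Y + ⋯)` as a list; `[g]` on the empty list).
[folklore] -/
def addFirst (g : ℤ) : List ℤ → List ℤ
  | [] => [g]
  | h :: hs => (g + h) :: hs

/-- Coefficient list of `(Y + r) · G(Y)` from that of `G`. [folklore] -/
def mulYr (r : ℤ) : List ℤ → List ℤ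
  | [] => []
  | g :: gs => (r * g) :: addFirst g (mulYr r gs)

/-- Coefficient list of the Taylor expansion at `r`: `F(Y + r) = Σ tᵢ Yⁱ` (`F = c + X·G`,
`F(Y + r) = c + (Y + r)·G(Y + r)`). [folklore] -/
def taylorList : List ℤ → ℤ → List ℤ
  | [], _ => []
  | c :: l, r => addFirst c (mulYr r (taylorList l r))

section Aeval

variable {A : Type*} [CommRing A] [Algebra ℤ A] (y : A)

/-- `aeval y (ofList (addFirst g l)) = g + aeval y (ofList l)`. [folklore] -/
theorem aeval_ofList_addFirst (g : ℤ) (l : List ℤ) :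
    aeval y (ofList (addFirst g l)) = (g : A) + aeval y (ofList l) := by
  cases l with
  | nil => simp [addFirst]
  | cons h hs => simp [addFirst, aeval_ofList_cons]; ring

/-- `aeval y (ofList (mulYr r l)) = (y + r) * aeval y (ofList l)`. [folklore] -/
theorem aeval_ofList_mulYr (r : ℤ) (l : List ℤ) :
    aeval y (ofList (mulYr r l)) = (y + (r : A)) * aeval y (ofList l) := by
  induction l with
  | nil => simp [mulYr]
  | cons g gs ih => simp [mulYr, aeval_ofList_cons, aeval_ofList_addFirst, ih]; ring

/-- **Taylor expansion**: `aeval y (ofList (taylorList l r)) = aeval (y + r) (ofList l)`.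
[folklore] -/
theorem aeval_ofList_taylorList (l : List ℤ) (r : ℤ) :
    aeval y (ofList (taylorList l r)) = aeval (y + (r : A)) (ofList l) := by
  induction l with
  | nil => simp [taylorList]
  | cons c l ih =>
    simp only [taylorList, aeval_ofList_addFirst, aeval_ofList_mulYr, ih, aeval_ofList_cons]

end Aeval

/-! ### A fuelled valuation -/

/-- `valFuel p fuel n`: the exponent of `p` in `n`, computed with `fuel` division steps (exact when
`fuel` exceeds the true valuation; in general a lower bound — only `p ^ valFuel ∣ n` is used).
[folklore] -/
def valFuel (p : ℕ) : ℕ → ℤ → ℕ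
  | 0, _ => 0
  | fuel + 1, n => if n ≠ 0 ∧ n % (p : ℤ) = 0 then valFuel p fuel (n / (p : ℤ)) + 1 else 0

/-- `p ^ valFuel p fuel n ∣ n`. [folklore] -/
theorem pow_valFuel_dvd (p : ℕ) : ∀ (fuel : ℕ) (n : ℤ), (p : ℤ) ^ valFuel p fuel n ∣ n
  | 0, n => by simp [valFuel]
  | fuel + 1, n => by
    simp only [valFuel]
    split_ifs with h
    · obtain ⟨-, hmod⟩ := h
      have hdvd : (p : ℤ) ∣ n := Int.dvd_of_emod_eq_zero hmod
      have ih := pow_valFuel_dvd p fuel (n / (p : ℤ))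
      rw [pow_succ]
      calc (p : ℤ) ^ valFuel p fuel (n / (p : ℤ)) * (p : ℤ) ∣ (n / (p : ℤ)) * (p : ℤ) :=
            mul_dvd_mul_right ih _
        _ = n := Int.ediv_mul_cancel hdvd
    · simp

/-! ### The exclusion test -/

/-- All tail Taylor terms are divisible by `p^{e+1}` on the class of level `j`:
`p^{e+1} ∣ cᵢ · p^{i j}` for `i = d, d+1, …` (the list `cs` starting at degree `d`). [folklore] -/
def tailOK (p : ℕ) (e j : ℕ) : ℕ → List ℤ → Bool
  | _, [] => true
  | d, c :: cs => ((c * (p : ℤ) ^ (d * j)) % ((p : ℤ) ^ (e + 1)) == 0) && tailOK p e j (d + 1) cs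

/-- **The Taylor exclusion test** for the class `r + p^j ℤ_p`: with `c₀, c₁, …` the Taylor
coefficients of `F` at `r` and `e = v_p(c₀)`: `c₀ ≠ 0`, `p^{e+1} ∤ c₀`, and `p^{e+1} ∣ cᵢ p^{ij}`
for all `i ≥ 1`. [folklore] -/
def dead (p : ℕ) (l : List ℤ) (j : ℕ) (r : ℤ) : Bool :=
  match taylorList l r with
  | [] => false
  | c₀ :: cs =>
    let e := valFuel p 64 c₀
    decide (c₀ ≠ 0) && !(c₀ % ((p : ℤ) ^ (e + 1)) == 0) && tailOK p e j 1 cs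

variable {p : ℕ} [hp : Fact p.Prime]

/-- The tail estimate: if `tailOK p e j d cs` then `‖y^d · (aeval y (ofList cs))‖ ≤ p^{-(e+1)}`
for `y = p^j t`, `t ∈ ℤ_p`. [folklore] -/
theorem norm_pow_mul_aeval_le_of_tailOK {e j : ℕ} (t : ℤ_[p]) :
    ∀ (d : ℕ) (cs : List ℤ), tailOK p e j d cs = true →
      ‖((p : ℤ_[p]) ^ j * t) ^ d * aeval ((p : ℤ_[p]) ^ j * t) (ofList cs)‖ ≤
        (p : ℝ) ^ (-((e + 1 : ℕ) : ℤ))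
  | d, [] => by
    intro
    simp only [aeval_ofList_nil, mul_zero, norm_zero]
    exact (zpow_pos (by exact_mod_cast hp.out.pos) _).le
  | d, c :: cs => by
    intro h
    simp only [tailOK, Bool.and_eq_true, beq_iff_eq, emod_eq_zero_iff_dvd'] at h
    obtain ⟨hc, htail⟩ := h
    have ih := norm_pow_mul_aeval_le_of_tailOK t (d + 1) cs htail
    rw [aeval_ofList_cons, mul_add]
    refine (PadicInt.nonarchimedean _ _).trans (max_le ?_ ?_)
    · -- the term `c · y^d = (c p^{dj}) · t^d`
      have : ((p : ℤ_[p]) ^ j * t) ^ d * (c : ℤ_[p]) =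
          ((c * (p : ℤ) ^ (d * j) : ℤ) : ℤ_[p]) * t ^ d := by
        push_cast; ring
      rw [this]
      calc ‖((c * (p : ℤ) ^ (d * j) : ℤ) : ℤ_[p]) * t ^ d‖
          = ‖((c * (p : ℤ) ^ (d * j) : ℤ) : ℤ_[p])‖ * ‖t ^ d‖ := norm_mul _ _
        _ ≤ (p : ℝ) ^ (-((e + 1 : ℕ) : ℤ)) * 1 :=
            mul_le_mul (norm_intCast_le_of_dvd hc)
              (by rw [norm_pow]; exact pow_le_one₀ (norm_nonneg _) (PadicInt.norm_le_one t))
              (norm_nonneg _) (zpow_pos (by exact_mod_cast hp.out.pos) _).le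
        _ = (p : ℝ) ^ (-((e + 1 : ℕ) : ℤ)) := mul_one _
    · have : ((p : ℤ_[p]) ^ j * t) ^ d *
          (((p : ℤ_[p]) ^ j * t) * aeval ((p : ℤ_[p]) ^ j * t) (ofList cs)) =
          ((p : ℤ_[p]) ^ j * t) ^ (d + 1) * aeval ((p : ℤ_[p]) ^ j * t) (ofList cs) := by ring
      rw [this]; exact ih

/-- **Soundness of the exclusion test**: if `dead p l j r` then `F = ofList l` has no root `z` with
`‖z − r‖ ≤ p^{-j}`. [folklore] -/
theorem aeval_ne_zero_of_dead {l : List ℤ} {j : ℕ} {r : ℤ} (h : dead p l j r = true)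
    {z : ℤ_[p]} (hz : ‖z - (r : ℤ_[p])‖ ≤ (p : ℝ) ^ (-(j : ℤ))) : aeval z (ofList l) ≠ 0 := by
  unfold dead at h
  split at h
  · simp at h
  · rename_i c₀ cs htl
    simp only [Bool.and_eq_true, decide_eq_true_eq, Bool.not_eq_true', beq_eq_false_iff_ne, ne_eq,
      emod_eq_zero_iff_dvd'] at h
    obtain ⟨⟨hc0, hndvd⟩, htail⟩ := h
    set e := valFuel p 64 c₀ with he
    -- `z = r + p^j t`
    rw [PadicInt.norm_le_pow_iff_mem_span_pow, Ideal.mem_span_singleton'] at hz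
    obtain ⟨t, ht⟩ := hz
    have hzr : z = ((p : ℤ_[p]) ^ j * t) + (r : ℤ_[p]) := by rw [mul_comm, ht]; ring
    rw [hzr, ← aeval_ofList_taylorList, htl, aeval_ofList_cons]
    -- `‖c₀‖ = p^{-e}` dominates the tail
    have hc0n : ‖(c₀ : ℤ_[p])‖ = (p : ℝ) ^ (-(e : ℤ)) :=
      norm_intCast_eq_of_dvd_of_not_dvd (pow_valFuel_dvd p 64 c₀) hndvd
    have htailn := norm_pow_mul_aeval_le_of_tailOK (e := e) (j := j) t 1 cs htail
    rw [pow_one] at htailn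
    have hlt :
        ‖((p : ℤ_[p]) ^ j * t) * aeval ((p : ℤ_[p]) ^ j * t) (ofList cs)‖ < ‖(c₀ : ℤ_[p])‖ := by
      rw [hc0n]
      exact htailn.trans_lt (zpow_lt_zpow_right₀ (by exact_mod_cast hp.out.one_lt)
        (by push_cast; omega))
    intro h0
    have := PadicInt.norm_add_eq_max_of_ne hlt.ne'
    rw [h0, norm_zero] at this
    have hpos : (0 : ℝ) < ‖(c₀ : ℤ_[p])‖ := by
      rw [hc0n]; exact zpow_pos (by exact_mod_cast hp.out.pos) _
    have : ‖(c₀ : ℤ_[p])‖ ≤ 0 := by rw [this]; exact le_max_left _ _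
    exact absurd this (not_le.mpr hpos)

/-! ### The strengthened checker -/

/-- ALIVE (v2): `F(r) ≡ 0 (mod p^j)`, not excluded by the Taylor test, in no certified ball.
[folklore] -/
def alive₂ (p : ℕ) (l : List ℤ) (cert : List (ℤ × ℕ × ℕ)) (j : ℕ) (r : ℤ) : Bool :=
  (evalList l r % ((p : ℤ) ^ j) == 0) && !(dead p l j r) && !(inBall p cert j r)

/-- One level of the v2 residue tree. [folklore] -/
def frontierStep₂ (p : ℕ) (l : List ℤ) (cert : List (ℤ × ℕ × ℕ)) (j : ℕ) (fr : List ℤ) :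
    List ℤ :=
  fr.flatMap fun r =>
    ((List.range p).map fun t : ℕ => r + (t : ℤ) * (p : ℤ) ^ j).filter (alive₂ p l cert (j + 1))

/-- The v2 tree search. [folklore] -/
def coverTree₂ (p : ℕ) (l : List ℤ) (cert : List (ℤ × ℕ × ℕ)) : ℕ → ℕ → List ℤ → Bool
  | 0, _, fr => fr.isEmpty
  | fuel + 1, j, fr => fr.isEmpty || coverTree₂ p l cert fuel (j + 1) (frontierStep₂ p l cert j fr)

/-- The v2 residue check. [folklore] -/
def coverOK₂ (p : ℕ) (l : List ℤ) (k : ℕ) (cert : List (ℤ × ℕ × ℕ)) : Bool :=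
  coverTree₂ p l cert k 0 [0]

/-- **The v2 root-census checker** (entries + disjointness as in `check`; residue search with the
Taylor exclusion test). [folklore] -/
def check₂ (p : ℕ) (l : List ℤ) (k : ℕ) (cert : List (ℤ × ℕ × ℕ)) : Bool :=
  cert.all (entryOK p l k) && pairwiseOK p cert && coverOK₂ p l k cert

/-- What `alive₂ … = false` means for a residue carrying `F ≡ 0` and a root in its class: it is in
a ball. -/
private theorem inBall_of_not_alive₂ {l : List ℤ} {cert : List (ℤ × ℕ × ℕ)} {j : ℕ} {r : ℤ}
    (hF : (p : ℤ) ^ j ∣ evalList l r) {z : ℤ_[p]} (hz0 : aeval z (ofList l) = 0)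
    (hz : ‖z - (r : ℤ_[p])‖ ≤ (p : ℝ) ^ (-(j : ℤ))) (ha : alive₂ p l cert j r = false) :
    ∃ e ∈ cert, e.2.1 + 1 ≤ j ∧ (p : ℤ) ^ (e.2.1 + 1) ∣ r - e.1 := by
  have hnd : dead p l j r = false := by
    by_contra hd
    rw [Bool.not_eq_false] at hd
    exact aeval_ne_zero_of_dead hd hz hz0
  simp only [alive₂, hnd, Bool.not_false, Bool.and_true, Bool.and_eq_false_imp, beq_iff_eq,
    emod_eq_zero_iff_dvd', Bool.not_eq_false', inBall, List.any_eq_true, Bool.and_eq_true,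
    decide_eq_true_eq] at ha
  exact ha hF |>.imp fun e he => ⟨he.1, he.2.1, he.2.2⟩

/-- **Soundness of the v2 tree search** (as `inBall_of_coverTree`, with the extra fact that the
class of a root is never `dead`). [folklore] -/
theorem inBall_of_coverTree₂ (l : List ℤ) (cert : List (ℤ × ℕ × ℕ)) :
    ∀ (fuel j : ℕ) (fr : List ℤ), coverTree₂ p l cert fuel j fr = true →
      (∀ z : ℤ_[p], aeval z (ofList l) = 0 →
        (∀ e ∈ cert, ¬ ‖z - (e.1 : ℤ_[p])‖ ≤ (p : ℝ) ^ (-((e.2.1 + 1 : ℕ) : ℤ))) →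
        ∃ r ∈ fr, ‖z - (r : ℤ_[p])‖ ≤ (p : ℝ) ^ (-(j : ℤ))) →
      ∀ z : ℤ_[p], aeval z (ofList l) = 0 →
        ∃ e ∈ cert, ‖z - (e.1 : ℤ_[p])‖ ≤ (p : ℝ) ^ (-((e.2.1 + 1 : ℕ) : ℤ)) := by
  intro fuel
  induction fuel with
  | zero =>
    intro j fr h hinv z hz
    by_contra hne
    simp only [not_exists, not_and] at hne
    obtain ⟨r, hr, -⟩ := hinv z hz hne
    simp only [coverTree₂, List.isEmpty_iff] at h
    rw [h] at hr; exact absurd hr (by simp)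
  | succ fuel ih =>
    intro j fr h hinv z hz
    by_contra hne
    simp only [not_exists, not_and] at hne
    simp only [coverTree₂, Bool.or_eq_true, List.isEmpty_iff] at h
    rcases h with h | h
    · obtain ⟨r, hr, -⟩ := hinv z hz hne
      rw [h] at hr; exact absurd hr (by simp)
    · suffices hinv' : ∀ z' : ℤ_[p], aeval z' (ofList l) = 0 →
          (∀ e ∈ cert, ¬ ‖z' - (e.1 : ℤ_[p])‖ ≤ (p : ℝ) ^ (-((e.2.1 + 1 : ℕ) : ℤ))) →
          ∃ r ∈ frontierStep₂ p l cert j fr, ‖z' - (r : ℤ_[p])‖ ≤ (p : ℝ) ^ (-((j + 1 : ℕ) : ℤ)) by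
        obtain ⟨e, he, hP⟩ := ih (j + 1) _ h (by exact_mod_cast hinv') z hz
        exact hne e he hP
      intro z' hz' hne'
      obtain ⟨r, hr, hzr⟩ := hinv z' hz' hne'
      obtain ⟨t, htp, hzt⟩ := exists_digit hzr
      refine ⟨r + (t : ℤ) * (p : ℤ) ^ j, ?_, hzt⟩
      have hF : (p : ℤ) ^ (j + 1) ∣ evalList l (r + (t : ℤ) * (p : ℤ) ^ j) := by
        have h1 := padic_polynomial_dist (ofList l) (((r + (t : ℤ) * (p : ℤ) ^ j : ℤ)) : ℤ_[p]) z'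
        rw [hz', sub_zero, aeval_intCast_ofList] at h1
        exact PadicInt.norm_int_le_pow_iff_dvd.mp
          (h1.trans (by rw [← norm_neg, neg_sub]; exact hzt))
      have halive : alive₂ p l cert (j + 1) (r + (t : ℤ) * (p : ℤ) ^ j) = true := by
        by_contra ha
        rw [Bool.not_eq_true] at ha
        obtain ⟨e, he, hej, hdvd⟩ := inBall_of_not_alive₂ hF hz' hzt ha
        apply hne' e he
        have hp1 : (1 : ℝ) ≤ p := by exact_mod_cast hp.out.one_lt.le
        have hrc : ‖(((r + (t : ℤ) * (p : ℤ) ^ j : ℤ)) : ℤ_[p]) - (e.1 : ℤ_[p])‖ ≤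
            (p : ℝ) ^ (-((e.2.1 + 1 : ℕ) : ℤ)) := by
          rw [← Int.cast_sub]; exact norm_intCast_le_of_dvd hdvd
        calc ‖z' - (e.1 : ℤ_[p])‖
            = ‖(z' - (((r + (t : ℤ) * (p : ℤ) ^ j : ℤ)) : ℤ_[p])) +
                ((((r + (t : ℤ) * (p : ℤ) ^ j : ℤ)) : ℤ_[p]) - (e.1 : ℤ_[p]))‖ := by ring_nf
          _ ≤ max ‖z' - (((r + (t : ℤ) * (p : ℤ) ^ j : ℤ)) : ℤ_[p])‖
                ‖(((r + (t : ℤ) * (p : ℤ) ^ j : ℤ)) : ℤ_[p]) - (e.1 : ℤ_[p])‖ :=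
              PadicInt.nonarchimedean _ _
          _ ≤ (p : ℝ) ^ (-((e.2.1 + 1 : ℕ) : ℤ)) :=
              max_le (hzt.trans (zpow_le_zpow_right₀ hp1 (by push_cast; omega))) hrc
      exact List.mem_flatMap.mpr ⟨r, hr, List.mem_filter.mpr
        ⟨List.mem_map.mpr ⟨t, List.mem_range.mpr htp, rfl⟩, halive⟩⟩

/-- What `coverOK₂` certifies: every root of `F` in `ℤ_p` lies in a certified ball. [folklore] -/
theorem inBall_of_coverOK₂ {l : List ℤ} {k : ℕ} {cert : List (ℤ × ℕ × ℕ)}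
    (h : coverOK₂ p l k cert = true) (z : ℤ_[p]) (hz : aeval z (ofList l) = 0) :
    ∃ e ∈ cert, ‖z - (e.1 : ℤ_[p])‖ ≤ (p : ℝ) ^ (-((e.2.1 + 1 : ℕ) : ℤ)) :=
  inBall_of_coverTree₂ l cert k 0 [0] h
    (fun z _ _ => ⟨0, List.mem_singleton.mpr rfl, by simpa using PadicInt.norm_le_one z⟩) z hz

/-- Sanity check of the kernel evaluation: `X² − 7` over `ℤ₃` again, and the route-1 pilot
22077e1's `Ψ₃` (one root, ball `(6, 1, 3)`; the ramified cubic factor's near-roots are excluded by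
the Taylor test within 16 levels). [folklore] -/
example : check₂ 3 [-7, 0, 1] 1 [((1 : ℤ), 0, 1), (-1, 0, 1)] = true := by decide

/-- The `Ψ₃` of the route-1 pilot 22077e1 (`[0, 0, 1, -5376115974, -151721379981842]`, type `I*₄₂`
at `3`): ONE root in `ℤ₃` (ball `(6, 1, 3)`); `check₂` succeeds in 16 levels / 51 nodes where the
plain `check` would need `3^{28}` residues. [folklore] -/
example : check₂ 3 [-28902622965897968676, -1820656559782101, -32256695844, 0, 3] 16
    [((6 : ℤ), 1, 3)] = true := by
  decide +kernel

end Summit.BirchSwinnertonDyer.Rank1Residual.GaloisImage.RootCensus
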